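import Summits.BirchSwinnertonDyer.BirchSwinnertonDyer.Theorems.KimAtThreeFineKatoRiderAssembly
import Summits.BirchSwinnertonDyer.BirchSwinnertonDyer.Theorems.KimAtThreeFineKatoSemiLocalLatticeInt
import Summits.BirchSwinnertonDyer.BirchSwinnertonDyer.Theorems.KimAtThreeFineKatoSemiLocalTransport
import HarnessLib

/-!
# SEMI-LOCAL ASSEMBLY for crux `KatoKuriharaPortThreeShared` (stmt-BirchSwinnertonDyer-19560): the
# defined-Kato package's ONE semi-local clause (SAT₀'s lattice `Λ₀`, unit-trace element, `exp*`-lattice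
# `M ⊆ Λ₀^∨`, COMPAT — stated in `ℚ₃ ⊗_ℚ ℚ(ζ_m)`) ⟸ a PER-FACTOR package over the completions
# `ℚ(ζ_m)_w`, `w ∣ 3`, transported along `Ψ : ℚ₃ ⊗ ℚ(ζ_m) ≃ ∏_{w∣3} ℚ(ζ_m)_w`; and the registered stub
# `stub_fineKato` (= ⟨C1⟩) from the per-factor package `hKloc`
# (cell `bsd-addord`, seat kim3 gen 14 = the crux's LEAD; route W2 `KimAtThreeKolyvagin`; `--supports 19560`)

HONEST FRAMING.  TOOL theorems only (no definition, no named fact, no `sorry`); closes nothing; nothing is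
booked; BSD is not proved by any of this.  State of record (HOME STATUS DECISION+FOLD 2026-08-27T03:45Z):
19560 ⟸ `stub_fineKato` (line `fineKato`) ⟸ `hK` = `stub_definedKatoPackage` (line `DefinedKato`, kim3 g13
p490927/p491642), and `hK`'s named pieces are w2-acc4's semi-local algebra `Ψ`/trace/`L_int′`
(p490337, p492685, p493033, p493286), w2-kport's `K_w`-logarithms (p488612 … p492700), w2-acc5's Galois
side at `w ∣ 3`, and the two `ℚ₃`-level print facts `hker`/`hdual` (cite items over
`defn-EllipticNeronDeRhamClass`).  Every one of those pieces is a statement INSIDE ONE LOCAL FIELD `L_w`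
(or `ℚ₃`); `hK`'s semi-local clause is a statement in the TENSOR ALGEBRA `ℚ₃ ⊗ ℚ(ζ_m)`.  THIS FILE does
the bookkeeping between the two once and for all, so that the pieces plug in BY NAME:

* (sibling file `KimAtThreeFineKatoSemiLocalTransport`, same seat/gen) `semiLocalInt_package_of_perFactor`
  (general prime `p`, general level `m`; pure semi-local algebra): given ANY `ℚ`-algebra isomorphism `Ψ : ℚ_[p] ⊗[ℚ] ℚ(ζ_m) ≃ₐ[ℚ] ∏_{w ∣ v_p} ℚ(ζ_m)_w` with w2-acc4's
  pure-tensor formula `Ψ(s ⊗ x)_w = x · e_p(s)` (`exists_padicTensorAlgEquiv`; `e_p = Padic.adicCompletionEquiv`)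
  and PER-FACTOR data — sets `Λ₀ʷ ⊆ 𝒪_w` containing `0`, sets `Mʷ ⊆ L_w` with
  `e_p⁻¹ Tr_{L_w/ℚ_v}(Mʷ · Λ₀ʷ) ⊆ ℤ_p`, ONE factor `w₀` with an element `ℓ₀ ∈ Λ₀^{w₀}` of unit trace
  `‖e_p⁻¹ Tr_{w₀} ℓ₀‖ = 1` — it produces the semi-local package in the `L_int′` currency:
  `Λ₀ := L_int′ ∩ Ψ⁻¹(∏_w Λ₀ʷ) ⊆ L_int′ := ℤ_p⟨1 ⊗ b : b ∈ 𝓞_{ℚ(ζ_m)}⟩` (ONTO: `exists_mem_span_padicTensor_eq`),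
  the unit-trace element `Ψ⁻¹(ℓ₀ at w₀, 0 elsewhere)` (`Tr = e_p⁻¹ Σ_w Tr_w`: `padicTensor_trace`),
  `M := ℤ_p⟨Ψ⁻¹(∏_w Mʷ)⟩` with `Tr(M·Λ₀) ⊆ ℤ_p` (span induction + the ultrametric inequality), and the
  COMPAT TRANSPORT `(∀ w, ∃ μ_w ∈ Mʷ, Ψ(D)_w = p^{k+1}·μ_w) ⟹ ∃ μ ∈ M, D = p^{k+1} • μ` (`Ψ` injective,
  `e_p`-semilinear: `padicTensor_map_smul`).
* §1 `exists_katoExpStarFiniteLevelAt_of_semiLocalInt`: kim3 g13's rider assembly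
  `exists_katoExpStarFiniteLevelAt_of_semiLocal` (p490927: `Λfin` CONSTRUCTED, rider clauses (i)/(ii) at
  every depth) with the lattice clause WEAKENED from `Λ₀ ⊆ cycIntLattice 3 m = ℤ₃⟨1 ⊗ ζ_m^j⟩` to
  `Λ₀ ⊆ L_int′(m)` — w2-acc4 g3's recommendation (STATUS 2026-08-27T03:39Z (iv)): `Ψ(L_int′) = ∏_w 𝒪_w`
  EXACTLY, whereas `Ψ(cycIntLattice) = ∏ 𝒪_w` would need `𝓞_{ℚ(ζ_m)} = ℤ[ζ_m]` (Mathlib: prime powers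
  only); clause (ii) is the ABSTRACT scalar core `KimAtThreePortSharedSATCore.toZModPow_eq_of_sub_eq_smul_of_sub_eq_smul`
  with `L := L_int′` ((hL) = `norm_trace_mul_le_one_span_ringOfIntegers`, premise moved by
  `cycIntLattice_premise_mem_span_ringOfIntegers`, both w2-acc4 p493286).
* §2 `fineKato_of_perFactorKatoPackage : hKloc → ⟨stub_fineKato signature VERBATIM⟩`, where the displayed
  PER-FACTOR DEFINED-KATO PACKAGE `hKloc` is `hK` with its semi-local clause replaced by the per-factor
  package of the transport file at `p = 3`, `m = cycLevel 3 0 r`, for EVERY `Ψ` with the pure-tensor formula, and the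
  PER-FACTOR COMPAT clause `Ψ(exp*_ω(h) ⊗ 1 − 3⁰·Λ_{0,r}(y))_w ∈ 3^{j+1}·Mʷ` under the derivative-class
  shape `res κ₀ = Ψ′ y`, `loc_{v₃} κ₀ = π_{j+1,*} h` (binders of p490927 VERBATIM).  The crux BY NAME from
  `hKloc` is the one-line composition with w2-c3's p471554 (sibling file
  `KimAtThreeFineKatoSemiLocalAssemblyCrux`, in the route file's import cone).

READING FOR THE RESIDUAL OF RECORD.  **19560 ⟸ ⟨C1⟩ ⟸ hKloc**, and `hKloc` speaks ONLY inside single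
local fields: (i) `φ = exp*_ω` on `H¹(ℚ₃, T₃W)` with `hker` ([BK90] 3.8/3.11) and `hdual` (Tate duality,
lattice form) — cite items; (ii) per `w ∣ 3` of `ℚ(ζ_m)` (unramified: `3 ∤ m`): `Λ₀ʷ = log_ω E₀(L_w) ⊆ 𝒪_w`
(w2-kport `norm_satLog_le_one_of_mem_nonsingularReductionSubgroup_of_addv`) with, at one `w₀`, a point of
unit trace (kport: `trace_satLog_eq_padicLog` + the residue-field step (r1)–(r4) of STATUS
2026-08-27T03:41Z + kim3 g12 (δ) `KimAtThreeFineKatoSATPoints`); (iii) `Mʷ = exp*_w(H¹(L_w, T))` with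
`Tr(Mʷ·Λ₀ʷ) ⊆ ℤ₃` ([BK90] 3.8 + duality over `L_w`, as (hdual)); (iv) per-factor COMPAT (exactness
`ker π_{j+1,*} = 3^{j+1}H¹(L_w,T)` = kim3 g13 `KimAtThreeFineKatoLocalExactness` over `L_w`, w2-acc5 g4's
`res ∘ loc` tower compatibility, `exp*` restriction-functoriality `dualExp_map`, Kato-v2's DEFINITION of
`Λ`); (v) R-κ ⟸ `3 ∤ c_P`; (vi) `ZetaBody` (Kato-v2).  The `∏_w`/`⊗` bookkeeping, the trace formula and
SAT₀ are KERNEL.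

NOT here: any `exp*`, any logarithm, any curve-specific computation over `L_w`; `Ψ` is not fixed (every
`Ψ` with the pure-tensor formula is admissible and they all agree on pure tensors); no numerics; no use of
Kim 2025 (PRE).  `p = 3` throughout (the crux's binders); the transport file is general.

References: S. Bloch, K. Kato (1990) §3 Prop. 3.8, Ex. 3.11 [BlochKato1990]; K. Kato, Astérisque 295 (2004)
(8.1.3), 8.12, §9.4, Thm. 9.7, Thm. 6.6 (1), Ex. 13.3 [Kato2004Asterisque]; C.-H. Kim, AJM 148 (2026)
§3.3–§3.4.1, Thm. 3.13 [Kim2022StructureSelmer]; C.-H. Kim, K. Nakamura, JNT 210 (2020) Thm. 2.1 / Cor. 2.4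
[KimNakamura2020]; J. W. S. Cassels, A. Fröhlich, *Algebraic Number Theory* (1967) Ch. II §10 (10.2), §11
[CasselsFrohlichANT1967]; J.-P. Serre, *Local Fields* II §3 Prop. 4 [SerreLocalFields1979]; kim3 memos
KIM3-W2-C1-g11 §2.4, KIM3-W2-C1b-KERNEL-g13 §3; w2-acc4 memo W2ACC4-g3-KPORT-NOTE; n1011 ROUTE-1 §53.3.
-/
noncomputable section

-- the cell's Theorems namespace `Summit.BirchSwinnertonDyer.BirchSwinnertonDyer.…` repeats the summit name by design (D-0017)
set_option linter.dupNamespace false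

open scoped Classical NumberField TensorProduct ContRepresentation
open Field NumberField IsDedekindDomain
open WeierstrassCurve Literature.NumberTheory.EllipticCurves Literature.NumberTheory.GaloisRepresentations
  Literature.NumberTheory.GaloisRepresentations.DiscreteGaloisModule Literature.NumberTheory.GaloisCohomology
open Literature.NumberTheory.EllipticCurves.ModularForms Literature.NumberTheory.EllipticCurves.Rank1Residual
open Literature.NumberTheory.EllipticCurves.Kato2004 Literature.NumberTheory.EllipticCurves.Kato2004.EulerSystemValues
open Literature.NumberTheory.AdelicBaseChange
open Summit.BirchSwinnertonDyer.Rank1Residual.GaloisImage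
open Summit.BirchSwinnertonDyer.Rank1Residual.Additive.LocalLog
open Summit.BirchSwinnertonDyer.BirchSwinnertonDyer.Theorems
open Summit.BirchSwinnertonDyer.BirchSwinnertonDyer.Theorems.KimAtThreePortSharedSATCore
open Summit.BirchSwinnertonDyer.BirchSwinnertonDyer.Theorems.KimAtThreeFineKatoSemiLocalLatticeInt
open Summit.BirchSwinnertonDyer.BirchSwinnertonDyer.Theorems.KimAtThreeFineKatoSemiLocalTransport

namespace Summit.BirchSwinnertonDyer.BirchSwinnertonDyer.Theorems.KimAtThreeFineKatoSemiLocalAssembly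

/-! ### §1. The (P-EXP) rider at every depth from the semi-local package in the `L_int′` currency
(kim3 g13 p490927 `exists_katoExpStarFiniteLevelAt_of_semiLocal` with «Λ₀ ⊆ cycIntLattice» WEAKENED to
«Λ₀ ⊆ L_int′ = ℤ₃⟨1 ⊗ 𝓞_{ℚ(ζ_m)}⟩», w2-acc4 g3's recommendation: `L_int′` is what `Ψ` identifies with `∏_w 𝒪_w`) -/

section Three

variable (W : WeierstrassCurve ℚ) [W.IsElliptic] [W.IsGloballyMinimal] [ContinuousSMul ℤ_[3] (W.tateModule 3)]

/-- **The FULL (P-EXP) rider `KatoExpStarFiniteLevelAt W 3 j 0 v₃ Λ Λfin_j` at EVERY depth, `Λfin`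
CONSTRUCTED, from the semi-local package in the `L_int′` currency.**  Identical to kim3 g13's
`KimAtThreeFineKatoRiderAssembly.exists_katoExpStarFiniteLevelAt_of_semiLocal` (p490927) except that the
lattice clause of the displayed package reads `Λ₀ ⊆ L_int′(m) := ℤ₃⟨1 ⊗ b : b ∈ 𝓞_{ℚ(ζ_m)}⟩` instead of
`Λ₀ ⊆ cycIntLattice 3 m = ℤ₃⟨1 ⊗ ζ_m^j⟩` — the lattice that the semi-local isomorphism
`Ψ : ℚ₃ ⊗ ℚ(ζ_m) ≃ ∏_{w∣3} ℚ(ζ_m)_w` carries EXACTLY onto `∏_w 𝒪_w` (w2-acc4 g3: `exists_padicTensorAlgEquiv`,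
`padicTensor_mem_adicCompletionIntegers_of_mem_span`, `exists_mem_span_padicTensor_eq`), so that a
log-lattice built factor by factor (`log_ω E₀(L_w) ⊆ 𝒪_w`) pulls back into it.  Clause (ii) is the
ABSTRACT scalar core `KimAtThreePortSharedSATCore.toZModPow_eq_of_sub_eq_smul_of_sub_eq_smul` with
`L := L_int′` (its (hL) = w2-acc4 g3 `norm_trace_mul_le_one_span_ringOfIntegers`; the rider's premise moves
from `cycIntLattice` to `L_int′` by `cycIntLattice_premise_mem_span_ringOfIntegers`); clause (i) and the
interface are kim3 g13's `exists_finLevelFunctional_clauses_three` unchanged.  Displayed: `φ = exp*_ω`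
with `hker`/`hdual`, and per `(j, r)` the package `(Λ₀ ⊆ L_int′, unit-trace element, M ⊆ Λ₀^∨, COMPAT)`.
Closes nothing.
[cite: Kim2022StructureSelmer, §3.3 (Lemma 3.11, Prop. 3.12), §3.4.1 and the proof of Thm. 3.13 (arXiv v3 pp. 26–27)]
[cite: BlochKato1990, §3 (Prop. 3.8, Ex. 3.11)] [cite: KimNakamura2020, Thm. 2.1 and Cor. 2.4] -/
theorem exists_katoExpStarFiniteLevelAt_of_semiLocalInt (hadd : Addv W 3)
    (hc : ¬ 3 ∣ (W.baseChange ℚ_[3]).localTamagawaNumber ℤ_[3])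
    (ht : Nat.card {Q : (W.baseChange ℚ_[3]).toAffine.Point // (3 : ℕ) • Q = 0} = 1)
    (v₃ : HeightOneSpectrum (𝓞 ℚ)) (hv₃ : ((3 : ℕ) : 𝓞 ℚ) ∈ v₃.asIdeal)
    (φ : (tateLocalRep W 3 (Sum.inr v₃)).cohomology 1 →+ ℚ_[3])
    (hker : ∀ y, φ y = 0 ↔ ∀ j : ℕ, tateLocalMap W 3 j (Sum.inr v₃) y ∈
      W.kummerSelmerStructure (((3 : ℕ) : ℤ) ^ j * ((3 : ℕ) : ℤ)) (Sum.inr v₃))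
    (hdual : ∀ a : ℚ_[3], (∃ y, φ y = a) ↔
      ∀ P : (W.baseChange ℚ_[3]).toAffine.Point, ‖a * padicLog (W.baseChange ℚ_[3]) P‖ ≤ 1)
    (Λ : ∀ (k' : ℕ) (r : Finset (HeightOneSpectrum (𝓞 ℚ))),
      H1 (tateRep W 3) (cycSubgroup 3 k' r) →ₗ[ℤ_[3]] ℚ_[3] ⊗[ℚ] CyclotomicField (cycLevel 3 k' r) ℚ)
    (hsemi : ∀ (j : ℕ) (r : Finset (HeightOneSpectrum (𝓞 ℚ))),
      ∃ (Λ₀ : Set (ℚ_[3] ⊗[ℚ] CyclotomicField (cycLevel 3 0 r) ℚ))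
        (M : Submodule ℤ_[3] (ℚ_[3] ⊗[ℚ] CyclotomicField (cycLevel 3 0 r) ℚ)),
        Λ₀ ⊆ Submodule.span ℤ_[3] (Set.range fun b : 𝓞 (CyclotomicField (cycLevel 3 0 r) ℚ) ↦
          (1 : ℚ_[3]) ⊗ₜ[ℚ] (b : CyclotomicField (cycLevel 3 0 r) ℚ)) ∧
        (∃ ℓ ∈ Λ₀, ‖Algebra.trace ℚ_[3] (ℚ_[3] ⊗[ℚ] CyclotomicField (cycLevel 3 0 r) ℚ) ℓ‖ = 1) ∧
        (∀ μ ∈ M, ∀ ℓ ∈ Λ₀,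
          ‖Algebra.trace ℚ_[3] (ℚ_[3] ⊗[ℚ] CyclotomicField (cycLevel 3 0 r) ℚ) (μ * ℓ)‖ ≤ 1) ∧
        ∀ (Ψ : H1 (tateRep W 3) (cycSubgroup 3 0 r) →+
            continuousCohomology 1 (subgroupRep
              (W.torsionGaloisModule (((3 : ℕ) : ℤ) ^ j * ((3 : ℕ) : ℤ))).toTopRep (cycSubgroup 3 0 r))),
          (∀ (φ' : contOneCocycles (subgroupRep (tateRep W 3).toTopRep (cycSubgroup 3 0 r)))
              (ψ : contOneCocycles (subgroupRep
                (W.torsionGaloisModule (((3 : ℕ) : ℤ) ^ j * ((3 : ℕ) : ℤ))).toTopRep (cycSubgroup 3 0 r))),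
              (∀ g, ((ψ.1 g : geomTorsion W (((3 : ℕ) : ℤ) ^ j * ((3 : ℕ) : ℤ))) : geomPoints W) =
                TateModule.proj 3 (j + 1) (φ'.1 g)) →
              Ψ (oneCocycleClass _ φ') = oneCocycleClass _ ψ) →
          ∀ (y : H1 (tateRep W 3) (cycSubgroup 3 0 r))
            (κ₀ : galoisCohomology (W.torsionGaloisModule (((3 : ℕ) : ℤ) ^ j * ((3 : ℕ) : ℤ))) 1)
            (h : (tateLocalRep W 3 (Sum.inr v₃)).cohomology 1),
            resSubgroup (W.torsionGaloisModule (((3 : ℕ) : ℤ) ^ j * ((3 : ℕ) : ℤ))).toTopRep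
                (cycSubgroup 3 0 r) 1 κ₀ = Ψ y →
            galoisCohomology.localization (W.torsionGaloisModule (((3 : ℕ) : ℤ) ^ j * ((3 : ℕ) : ℤ)))
                (Sum.inr v₃) 1 κ₀ = tateLocalMap W 3 j (Sum.inr v₃) h →
            ∃ μ ∈ M, (φ h ⊗ₜ[ℚ] (1 : CyclotomicField (cycLevel 3 0 r) ℚ)) -
                (((3 : ℕ) : ℤ_[3]) ^ (0 : ℕ)) • Λ 0 r y = (((3 : ℕ) : ℤ_[3]) ^ (j + 1)) • (μ : _)) :
    ∃ Λfin : ∀ j : ℕ, galoisCohomology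
        ((W.torsionGaloisModule (((3 : ℕ) : ℤ) ^ j * ((3 : ℕ) : ℤ))).toLocal (Sum.inr v₃)) 1 →+
          ZMod (3 ^ (j + 1)),
      (∀ j : ℕ, KatoExpStarFiniteLevelAt W 3 j 0 v₃ Λ (Λfin j)) ∧
      (∀ (j : ℕ) (y : (tateLocalRep W 3 (Sum.inr v₃)).cohomology 1) (s : ℤ_[3]), φ y = s →
        Λfin j (tateLocalMap W 3 j (Sum.inr v₃) y) = PadicInt.toZModPow (j + 1) s) := by
  obtain ⟨hint, -⟩ := KimAtThreeFineKatoLemmaL.lemmaL_range_three W hadd hc ht v₃ φ hdual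
  obtain ⟨Λfin, hI, hΛ⟩ :=
    KimAtThreeFineKatoLemmaL.exists_finLevelFunctional_clauses_three W hadd hc ht v₃ hv₃ φ hker hdual
  refine ⟨Λfin, fun j => ⟨(hI j).1, (hI j).2, ?_⟩, hΛ⟩
  -- clause (ii): the tame-level scalar compatibility, from the semi-local package (L_int′ form) and SAT₀
  intro r Ψ hΨ y κ₀ s hres hloc hval
  obtain ⟨Λ₀, M, hΛ₀, hu, hM, hcompat⟩ := hsemi j r
  obtain ⟨h, hh⟩ := (mem_propagatedSelmerStructure_iff W 3 j (Sum.inr v₃) _).mp hloc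
  obtain ⟨μ, hμ, he⟩ := hcompat Ψ hΨ y κ₀ h hres hh.symm
  set e : ℤ_[3] := ⟨φ h, hint h⟩ with hedef
  have hφe : φ h = (e : ℚ_[3]) := rfl
  rw [← hh, hΛ j h e hφe]
  rw [hφe] at he
  obtain ⟨l, hl, hs⟩ := cycIntLattice_premise_mem_span_ringOfIntegers 3 (cycLevel 3 0 r) hval
  rw [coe_tmul_one_eq_algebraMap] at he hs
  exact toZModPow_eq_of_sub_eq_smul_of_sub_eq_smul (Algebra.trace ℚ_[3] _)
    (norm_trace_mul_le_one_span_ringOfIntegers 3 (cycLevel 3 0 r) hΛ₀) hM hu hμ hl he hs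


/-! ### §2. The registered stub `stub_fineKato` (= ⟨C1⟩) of crux `KatoKuriharaPortThreeShared` from the
PER-FACTOR defined-Kato package `hKloc` — the semi-local tensor algebra DONE here, once and for all -/

/-- **`stub_fineKato` (⟨C1⟩, signature VERBATIM as registered on stmt-BirchSwinnertonDyer-19560) FROM THE
PER-FACTOR DEFINED-KATO PACKAGE `hKloc`.**  `hKloc` is kim3 g13's displayed package `hK`
(`KimAtThreeFineKatoRiderAssembly.fineKato_of_definedKatoPackage`, registered as `stub_definedKatoPackage`
of line `DefinedKato`) with its ONE semi-local clause — per depth `j` and tame level `r`, in the algebra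
`ℚ₃ ⊗_ℚ ℚ(ζ_m)`: a lattice `Λ₀ ⊆ L_int` with a unit-trace element, `M ⊆ Λ₀^∨`, COMPAT — REPLACED by its
PER-FACTOR form over the completions `L_w = ℚ(ζ_m)_w`, `w ∣ 3` (read through ANY semi-local isomorphism
`Ψ : ℚ₃ ⊗ ℚ(ζ_m) ≃ₐ ∏_{w∣3} L_w` with the pure-tensor formula of w2-acc4's `exists_padicTensorAlgEquiv`):
for each `w`, a set `Λ₀ʷ ⊆ 𝒪_w` containing `0` (intended: `log_ω E₀(L_w)`, seats w2-kport / w2-acc4), a set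
`Mʷ ⊆ L_w` (intended: `exp*_w(H¹(L_w, T₃W))`) with `Tr_{L_w/ℚ₃}(Mʷ·Λ₀ʷ) ⊆ ℤ₃` ([BK90] 3.8 + duality over
`L_w`), ONE factor `w₀` with an element of `Λ₀^{w₀}` of unit trace (kport's consumer theorem
`∃ P ∈ E₀(K), Tr(log P) ∈ ℤ₃ˣ` for `K = L_{w₀}`), and the PER-FACTOR COMPAT clause
`Ψ(exp*_ω(h) ⊗ 1 − Λ_{0,r}(y))_w ∈ 3^{j+1}·Mʷ` (exactness over `L_w` + restriction-compatibility of `exp*` +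
Kato-v2's definition `Λ_{0,r} := Ψ⁻¹(exp*_w ∘ loc_w)_w` — seat w2-acc5's Galois-side plumbing).  All traces
are pulled back to `ℚ₃` along Mathlib's `e₃ : ℚ_[3] ≃ ℚ_{v₃}` (`Padic.adicCompletionEquiv`).  Proof: the transport file
transports the per-factor package to the `L_int′` package (`Λ₀ := L_int′ ∩ Ψ⁻¹(∏Λ₀ʷ)`,
`M := ℤ₃⟨Ψ⁻¹(∏Mʷ)⟩`, unit-trace element `Ψ⁻¹(ℓ₀ at w₀, 0 elsewhere)`, `Tr = e₃⁻¹ Σ_w Tr_w`), §1 builds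
`Λfin` and proves the rider at every depth.  So the crux's residual reads **19560 ⟸ ⟨C1⟩ ⟸ hKloc**, and
`hKloc` contains NO tensor-product bookkeeping any more: every remaining clause is a statement inside ONE
local field (`ℚ₃` or one `L_w`).  `hKloc` displayed; closes nothing; nothing booked.
[cite: Kato2004Asterisque, (8.1.3) (p. 180), Prop. 8.12 (p. 186), §9.4 and Thm. 9.7 (pp. 188–189), Thm. 6.6 (1) (p. 163), Ex. 13.3 (pp. 224–225)]
[cite: BlochKato1990, §3 (Prop. 3.8, Ex. 3.11)] [cite: Kim2022StructureSelmer, §3.3–§3.4.1 and Thm. 3.13]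
[cite: CasselsFrohlichANT1967, Ch. II §10 Theorem (10.2)] -/
theorem fineKato_of_perFactorKatoPackage
    (hKloc : ∀ (W : WeierstrassCurve ℚ) [W.IsElliptic] [W.IsGloballyMinimal]
      [ContinuousSMul ℤ_[3] (W.tateModule 3)] [Module.Free ℤ_[3] (W.tateModule 3)]
      [Module.Finite ℤ_[3] (W.tateModule 3)],
      (∀ m : ℕ, W.HasSurjectiveModNGaloisRep (3 ^ m : ℕ)) →
      (haveI : Fact (Nat.Prime 3) := ⟨Nat.prime_three⟩; Addv W 3) →
      ¬ 3 ∣ (W.baseChange ℚ_[3]).localTamagawaNumber ℤ_[3] →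
      Nat.card {Q : (W.baseChange ℚ_[3]).toAffine.Point // (3 : ℕ) • Q = 0} = 1 →
      ∀ (v₃ : HeightOneSpectrum (𝓞 ℚ)), ((3 : ℕ) : 𝓞 ℚ) ∈ v₃.asIdeal →
      ∀ {N : ℕ} [NeZero N] (P : ModularParametrizationData W N), N = W.conductorNorm ℤ →
        (∀ z ∈ P.L.lattice, ∃ w ∈ periodLattice P.f, z = P.c * w) →
        ¬ (3 : ℤ) ∣ P.maninConstant →
        ∃ (ι : (n : ℕ) → (CyclotomicField n ℚ →+* ℂ)) (κK : ℝ)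
          (Λ : ∀ (k' : ℕ) (r : Finset (HeightOneSpectrum (𝓞 ℚ))),
            H1 (tateRep W 3) (cycSubgroup 3 k' r) →ₗ[ℤ_[3]]
              ℚ_[3] ⊗[ℚ] CyclotomicField (cycLevel 3 k' r) ℚ)
          (φ : (tateLocalRep W 3 (Sum.inr v₃)).cohomology 1 →+ ℚ_[3]),
          κK ≠ 0 ∧ (∃ u : ℚ, (u : ℝ) = κK ∧ padicValRat 3 u = 0) ∧
          (∀ y, φ y = 0 ↔ ∀ j : ℕ, tateLocalMap W 3 j (Sum.inr v₃) y ∈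
            W.kummerSelmerStructure (((3 : ℕ) : ℤ) ^ j * ((3 : ℕ) : ℤ)) (Sum.inr v₃)) ∧
          (∀ a : ℚ_[3], (∃ y, φ y = a) ↔
            ∀ Q : (W.baseChange ℚ_[3]).toAffine.Point, ‖a * padicLog (W.baseChange ℚ_[3]) Q‖ ≤ 1) ∧
          (∀ (j : ℕ) (r : Finset (HeightOneSpectrum (𝓞 ℚ)))
            (Ψ : ℚ_[3] ⊗[ℚ] CyclotomicField (cycLevel 3 0 r) ℚ ≃ₐ[ℚ]
              (Π w : ((Rat.HeightOneSpectrum.primesEquiv (R := 𝓞 ℚ)).symm ⟨3, Fact.out⟩).Extension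
                (𝓞 (CyclotomicField (cycLevel 3 0 r) ℚ)), w.1.adicCompletion (CyclotomicField (cycLevel 3 0 r) ℚ))),
            (∀ (s : ℚ_[3]) (x : CyclotomicField (cycLevel 3 0 r) ℚ)
              (w : ((Rat.HeightOneSpectrum.primesEquiv (R := 𝓞 ℚ)).symm ⟨3, Fact.out⟩).Extension
                (𝓞 (CyclotomicField (cycLevel 3 0 r) ℚ))),
              Ψ (s ⊗ₜ[ℚ] x) w =
                algebraMap (CyclotomicField (cycLevel 3 0 r) ℚ) (w.1.adicCompletion (CyclotomicField (cycLevel 3 0 r) ℚ)) x *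
                algebraMap (((Rat.HeightOneSpectrum.primesEquiv (R := 𝓞 ℚ)).symm ⟨3, Fact.out⟩).adicCompletion ℚ)
                  (w.1.adicCompletion (CyclotomicField (cycLevel 3 0 r) ℚ)) (Padic.adicCompletionEquiv (𝓞 ℚ) ⟨3, Fact.out⟩ s)) →
            ∃ (Λ₀' M' : ∀ w : ((Rat.HeightOneSpectrum.primesEquiv (R := 𝓞 ℚ)).symm ⟨3, Fact.out⟩).Extension
                (𝓞 (CyclotomicField (cycLevel 3 0 r) ℚ)), Set (w.1.adicCompletion (CyclotomicField (cycLevel 3 0 r) ℚ))),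
              (∀ w, Λ₀' w ⊆ w.1.adicCompletionIntegers (CyclotomicField (cycLevel 3 0 r) ℚ)) ∧
              (∀ w, (0 : w.1.adicCompletion (CyclotomicField (cycLevel 3 0 r) ℚ)) ∈ Λ₀' w) ∧
              (∃ w₀, ∃ ℓ₀ ∈ Λ₀' w₀, ‖(Padic.adicCompletionEquiv (𝓞 ℚ) ⟨3, Fact.out⟩).symm
                (Algebra.trace (((Rat.HeightOneSpectrum.primesEquiv (R := 𝓞 ℚ)).symm ⟨3, Fact.out⟩).adicCompletion ℚ)
                  (w₀.1.adicCompletion (CyclotomicField (cycLevel 3 0 r) ℚ)) ℓ₀)‖ = 1) ∧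
              (∀ w, ∀ μ ∈ M' w, ∀ ℓ ∈ Λ₀' w, ‖(Padic.adicCompletionEquiv (𝓞 ℚ) ⟨3, Fact.out⟩).symm
                (Algebra.trace (((Rat.HeightOneSpectrum.primesEquiv (R := 𝓞 ℚ)).symm ⟨3, Fact.out⟩).adicCompletion ℚ)
                  (w.1.adicCompletion (CyclotomicField (cycLevel 3 0 r) ℚ)) (μ * ℓ))‖ ≤ 1) ∧
              ∀ (Ψ' : H1 (tateRep W 3) (cycSubgroup 3 0 r) →+
                  continuousCohomology 1 (subgroupRep
                    (W.torsionGaloisModule (((3 : ℕ) : ℤ) ^ j * ((3 : ℕ) : ℤ))).toTopRep (cycSubgroup 3 0 r))),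
                (∀ (φ' : contOneCocycles (subgroupRep (tateRep W 3).toTopRep (cycSubgroup 3 0 r)))
                    (ψ : contOneCocycles (subgroupRep
                      (W.torsionGaloisModule (((3 : ℕ) : ℤ) ^ j * ((3 : ℕ) : ℤ))).toTopRep (cycSubgroup 3 0 r))),
                    (∀ g, ((ψ.1 g : geomTorsion W (((3 : ℕ) : ℤ) ^ j * ((3 : ℕ) : ℤ))) : geomPoints W) =
                      TateModule.proj 3 (j + 1) (φ'.1 g)) →
                    Ψ' (oneCocycleClass _ φ') = oneCocycleClass _ ψ) →
                ∀ (y : H1 (tateRep W 3) (cycSubgroup 3 0 r))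
                  (κ₀ : galoisCohomology (W.torsionGaloisModule (((3 : ℕ) : ℤ) ^ j * ((3 : ℕ) : ℤ))) 1)
                  (h : (tateLocalRep W 3 (Sum.inr v₃)).cohomology 1),
                  resSubgroup (W.torsionGaloisModule (((3 : ℕ) : ℤ) ^ j * ((3 : ℕ) : ℤ))).toTopRep
                      (cycSubgroup 3 0 r) 1 κ₀ = Ψ' y →
                  galoisCohomology.localization (W.torsionGaloisModule (((3 : ℕ) : ℤ) ^ j * ((3 : ℕ) : ℤ)))
                      (Sum.inr v₃) 1 κ₀ = tateLocalMap W 3 j (Sum.inr v₃) h →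
                  ∀ w, ∃ μ ∈ M' w,
                    Ψ ((φ h ⊗ₜ[ℚ] (1 : CyclotomicField (cycLevel 3 0 r) ℚ)) -
                        (((3 : ℕ) : ℤ_[3]) ^ (0 : ℕ)) • Λ 0 r y) w =
                      (((3 : ℕ) : w.1.adicCompletion (CyclotomicField (cycLevel 3 0 r) ℚ)) ^ (j + 1)) * μ) ∧
          ∀ (c d a : ℤ) (A : ℕ), 0 < A → Int.gcd c (6 * 3 * A) = 1 → Int.gcd d (6 * 3 * N) = 1 →
            ∃ (z : ∀ (k' : ℕ) (r : (cyclotomicLevelsRat 3 (badPlaces c d A N)).Ideals),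
                  H1 (tateRep W 3) ((cyclotomicLevelsRat 3 (badPlaces c d A N)).level k' r.1))
              (x : ∀ (k' : ℕ) (r : (cyclotomicLevelsRat 3 (badPlaces c d A N)).Ideals),
                  CyclotomicField (cycLevel 3 k' r.1) ℚ),
              ZetaBody W 3 P.f ι κK Λ c d a A z x) :
    ∀ (W : WeierstrassCurve ℚ) [W.IsElliptic] [W.IsGloballyMinimal]
      [ContinuousSMul ℤ_[3] (W.tateModule 3)] [Module.Free ℤ_[3] (W.tateModule 3)]
      [Module.Finite ℤ_[3] (W.tateModule 3)],
      (∀ m : ℕ, W.HasSurjectiveModNGaloisRep (3 ^ m : ℕ)) →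
      (haveI : Fact (Nat.Prime 3) := ⟨Nat.prime_three⟩; Addv W 3) →
      ¬ 3 ∣ (W.baseChange ℚ_[3]).localTamagawaNumber ℤ_[3] →
      Nat.card {Q : (W.baseChange ℚ_[3]).toAffine.Point // (3 : ℕ) • Q = 0} = 1 →
      ∀ (v₃ : HeightOneSpectrum (𝓞 ℚ)), ((3 : ℕ) : 𝓞 ℚ) ∈ v₃.asIdeal →
      ∀ {N : ℕ} [NeZero N] (P : ModularParametrizationData W N), N = W.conductorNorm ℤ →
        (∀ z ∈ P.L.lattice, ∃ w ∈ periodLattice P.f, z = P.c * w) →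
        ¬ (3 : ℤ) ∣ P.maninConstant →
        ∃ (ι : (n : ℕ) → (CyclotomicField n ℚ →+* ℂ)) (κK : ℝ)
          (Λ : ∀ (k' : ℕ) (r : Finset (HeightOneSpectrum (𝓞 ℚ))),
            H1 (tateRep W 3) (cycSubgroup 3 k' r) →ₗ[ℤ_[3]]
              ℚ_[3] ⊗[ℚ] CyclotomicField (cycLevel 3 k' r) ℚ)
          (Λfin : ∀ j : ℕ, galoisCohomology
            ((W.torsionGaloisModule (((3 : ℕ) : ℤ) ^ j * ((3 : ℕ) : ℤ))).toLocal (Sum.inr v₃)) 1 →+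
              ZMod (3 ^ (j + 1))),
          κK ≠ 0 ∧ (∃ u : ℚ, (u : ℝ) = κK ∧ padicValRat 3 u = 0) ∧
          (∀ j : ℕ, KatoExpStarFiniteLevelAt W 3 j 0 v₃ Λ (Λfin j)) ∧
          ∀ (c d a : ℤ) (A : ℕ), 0 < A → Int.gcd c (6 * 3 * A) = 1 → Int.gcd d (6 * 3 * N) = 1 →
            ∃ (z : ∀ (k' : ℕ) (r : (cyclotomicLevelsRat 3 (badPlaces c d A N)).Ideals),
                  H1 (tateRep W 3) ((cyclotomicLevelsRat 3 (badPlaces c d A N)).level k' r.1))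
              (x : ∀ (k' : ℕ) (r : (cyclotomicLevelsRat 3 (badPlaces c d A N)).Ideals),
                  CyclotomicField (cycLevel 3 k' r.1) ℚ),
              ZetaBody W 3 P.f ι κK Λ c d a A z x  := by
  intro W _ _ _ _ _ htow hadd hc ht v₃ hv₃ N _ P hN hlat hman
  obtain ⟨ι, κK, Λ, φ, hκ0, hκu, hker, hdual, hloc, hz⟩ := hKloc W htow hadd hc ht v₃ hv₃ P hN hlat hman
  have hsemi : ∀ (j : ℕ) (r : Finset (HeightOneSpectrum (𝓞 ℚ))),
      ∃ (Λ₀ : Set (ℚ_[3] ⊗[ℚ] CyclotomicField (cycLevel 3 0 r) ℚ))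
        (M : Submodule ℤ_[3] (ℚ_[3] ⊗[ℚ] CyclotomicField (cycLevel 3 0 r) ℚ)),
        Λ₀ ⊆ Submodule.span ℤ_[3] (Set.range fun b : 𝓞 (CyclotomicField (cycLevel 3 0 r) ℚ) ↦
          (1 : ℚ_[3]) ⊗ₜ[ℚ] (b : CyclotomicField (cycLevel 3 0 r) ℚ)) ∧
        (∃ ℓ ∈ Λ₀, ‖Algebra.trace ℚ_[3] (ℚ_[3] ⊗[ℚ] CyclotomicField (cycLevel 3 0 r) ℚ) ℓ‖ = 1) ∧
        (∀ μ ∈ M, ∀ ℓ ∈ Λ₀,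
          ‖Algebra.trace ℚ_[3] (ℚ_[3] ⊗[ℚ] CyclotomicField (cycLevel 3 0 r) ℚ) (μ * ℓ)‖ ≤ 1) ∧
        ∀ (Ψ : H1 (tateRep W 3) (cycSubgroup 3 0 r) →+
            continuousCohomology 1 (subgroupRep
              (W.torsionGaloisModule (((3 : ℕ) : ℤ) ^ j * ((3 : ℕ) : ℤ))).toTopRep (cycSubgroup 3 0 r))),
          (∀ (φ' : contOneCocycles (subgroupRep (tateRep W 3).toTopRep (cycSubgroup 3 0 r)))
              (ψ : contOneCocycles (subgroupRep
                (W.torsionGaloisModule (((3 : ℕ) : ℤ) ^ j * ((3 : ℕ) : ℤ))).toTopRep (cycSubgroup 3 0 r))),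
              (∀ g, ((ψ.1 g : geomTorsion W (((3 : ℕ) : ℤ) ^ j * ((3 : ℕ) : ℤ))) : geomPoints W) =
                TateModule.proj 3 (j + 1) (φ'.1 g)) →
              Ψ (oneCocycleClass _ φ') = oneCocycleClass _ ψ) →
          ∀ (y : H1 (tateRep W 3) (cycSubgroup 3 0 r))
            (κ₀ : galoisCohomology (W.torsionGaloisModule (((3 : ℕ) : ℤ) ^ j * ((3 : ℕ) : ℤ))) 1)
            (h : (tateLocalRep W 3 (Sum.inr v₃)).cohomology 1),
            resSubgroup (W.torsionGaloisModule (((3 : ℕ) : ℤ) ^ j * ((3 : ℕ) : ℤ))).toTopRep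
                (cycSubgroup 3 0 r) 1 κ₀ = Ψ y →
            galoisCohomology.localization (W.torsionGaloisModule (((3 : ℕ) : ℤ) ^ j * ((3 : ℕ) : ℤ)))
                (Sum.inr v₃) 1 κ₀ = tateLocalMap W 3 j (Sum.inr v₃) h →
            ∃ μ ∈ M, (φ h ⊗ₜ[ℚ] (1 : CyclotomicField (cycLevel 3 0 r) ℚ)) -
                (((3 : ℕ) : ℤ_[3]) ^ (0 : ℕ)) • Λ 0 r y = (((3 : ℕ) : ℤ_[3]) ^ (j + 1)) • (μ : _) := by
    intro j r
    obtain ⟨Ψ, hΨ⟩ := exists_padicTensorAlgEquiv (CyclotomicField (cycLevel 3 0 r) ℚ) 3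
    obtain ⟨Λ₀', M', hΛ₀', h0, hu', hM', hcompat⟩ := hloc j r Ψ hΨ
    obtain ⟨Λ₀, M, hΛ₀, hu, hM, htrans⟩ :=
      semiLocalInt_package_of_perFactor 3 (cycLevel 3 0 r) Ψ hΨ Λ₀' M' hΛ₀' h0 hu' hM'
    refine ⟨Λ₀, M, hΛ₀, hu, hM, ?_⟩
    intro Ψ' hΨ' y κ₀ h hres hloc'
    exact htrans j _ (hcompat Ψ' hΨ' y κ₀ h hres hloc')
  obtain ⟨Λfin, hrider, -⟩ :=
    exists_katoExpStarFiniteLevelAt_of_semiLocalInt W hadd hc ht v₃ hv₃ φ hker hdual Λ hsemi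
  exact ⟨ι, κK, Λ, Λfin, hκ0, hκu, hrider, hz⟩

end Three


end Summit.BirchSwinnertonDyer.BirchSwinnertonDyer.Theorems.KimAtThreeFineKatoSemiLocalAssembly

end
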